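import Mathlib
import HarnessLib
import Literature.MathematicalPhysics.StatisticalMechanics.KosterlitzRecursionFlowRobust

/-!
# The renormalised stiffness of a Kosterlitz-type flow is `0` or at least `2/π` (dichotomy)

Topic `Literature/MathematicalPhysics/StatisticalMechanics`. Fourth file of the group
`KosterlitzThoulessStiffnessBound` · `KosterlitzRecursionFlow` · `KosterlitzRecursionFlowRobust` ·
`KosterlitzUniversalJumpRobust`. The robust stability theorem of `KosterlitzRecursionFlowRobust` says:
on a Kosterlitz-type trajectory (`IsPerturbedFlowTrajectory C u y`: `K⁻¹(ℓ)` non-decreasing,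
`dy/dℓ = (2 - π·K)·y + O(y³)`) that FLOWS INTO THE FIXED LINE (`y(ℓ) → 0`) the running stiffness
converges to `K_R ∈ [2/π, K(0)]`. Here the hypothesis `y(ℓ) → 0` is removed in favour of a
DICHOTOMY, at the price of the lower envelope of Nelson's eq. (2.61a),

  `dK⁻¹(ℓ)/dℓ ≥ A₁·y(ℓ)²`,  `A₁ > 0`

(`dK⁻¹/dℓ = 4π³y² + O(y⁴)` with the sign of the correction absorbed; for the truncated flow
`A₁ = A`, `IsFlowTrajectory.hasInvGrowth`): EVERY such trajectory either flows into the fixed line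
(`y → 0`, hence `K_R ≥ 2/π`) or has its stiffness renormalised to zero (`K⁻¹ → ∞`, `K_R = 0`). There
is no third long-distance behaviour — in particular no trajectory stalls at a finite `K⁻¹` with
vortices still present. Consequently the renormalised stiffness `K_R = lim_ℓ K(ℓ)` of ANY
Kosterlitz-type flow exists and is QUANTISED to `{0} ∪ [2/π, K(0)]`, and a POSITIVE renormalised
stiffness is automatically `≥ 2/π`: the Kosterlitz–Thouless stability inequality
`KosterlitzThouless.StableBelow ρ T_c` follows from the identification `ρ(T)/T = lim_ℓ K_T(ℓ)` ALONE
once `T_c` is read off the stiffness curve as the temperature below which `ρ > 0`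
(`KosterlitzThouless.IsTransitionAt`, Nelson 2002 §6.2: the superfluid density "jumps
discontinuously to zero at `T_c`").

## What is PROVED

* `IsPerturbedFlowTrajectory.inv_sq_fug_le` — the WINDOW LEMMA (backward Grönwall bound on `y⁻²`
  from `dy/dℓ ≤ 2y + C·y³`): `y(s)⁻² + C/2 ≤ (y(t)⁻² + C/2)·e^{4(t-s)}` for `0 ≤ s ≤ t` — a late
  excursion `y(t) ≥ η` of the fugacity forces `y` to be bounded below on the unit window before `t`.
* `IsPerturbedFlowTrajectory.exists_tendsto_or_tendsto_atTop` — `K⁻¹(ℓ)` (monotone) converges to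
  a finite limit or tends to `+∞`.
* `IsPerturbedFlowTrajectory.tendsto_fug_zero_of_tendsto_inv` — with the lower envelope: if
  `K⁻¹(ℓ)` converges then `y(ℓ) → 0` (a late excursion of `y` would make `K⁻¹` gain at least
  `A₁·m` over a unit window, contradicting the Cauchy property of a convergent `K⁻¹`).
* `IsPerturbedFlowTrajectory.tendsto_fug_zero_or_tendsto_atTop` — **the dichotomy**: `y → 0` or
  `K⁻¹ → ∞`.
* `IsPerturbedFlowTrajectory.exists_tendsto_stiffness_dichotomy` — **quantisation of the
  renormalised stiffness**: `K(ℓ) → K_R` with `K_R = 0` or (`2/π ≤ K_R ≤ K(0)` and `y → 0`);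
  `.two_div_pi_le_of_tendsto_stiffness_pos` — a positive limit stiffness is `≥ 2/π`.
* BRIDGES: `stableBelow_of_pos_of_robustFlowLimit` / `stableBelow_of_isTransitionAt_of_robustFlowLimit`
  — identification at every `0 < T < T_c` + positivity of `ρ` there (resp. `IsTransitionAt ρ T_c`)
  ⇒ `StableBelow ρ T_c`; `le_pi_div_two_mul_of_isTransitionAt_of_robustFlowLimit` — with a ceiling
  `ρ ≤ ρ̄` on `(0, T_c)`, `T_c ≤ (π/2)·ρ̄`.

## Rigour status

Elementary real analysis on given trajectories (no existence theorem for the flow needed or claimed).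
What remains a renormalisation-group HYPOTHESIS about a physical system is the description of its
stiffness by such a flow: the identification `ρ_s^R(T)/T = lim_ℓ K_T(ℓ)` (Nelson 2002, eq. (2.70))
for a Kosterlitz-type trajectory with the lower envelope — the hypothesis of the bridges, verbatim.

## Not here

No robust basin of attraction (that the fixed line attracts nearby data for `K > 2/π`), no
derivation of the separatrix-end hypothesis of `KosterlitzUniversalJumpRobust`; no microscopic model.

## References

* J. M. Kosterlitz, J. Phys. C 7 (1974) 1046. [Kosterlitz1974]
* D. R. Nelson, *Defects and Geometry in Condensed Matter Physics*, CUP 2002, §2.2.3,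
  eqs. (2.57)–(2.62), (2.70)–(2.72), Fig. 2.6; §6.2, Fig. 6.2. [Nelson2002Defects]
-/

noncomputable section

open Filter Topology Set Real

namespace Literature.MathematicalPhysics.StatisticalMechanics

namespace KosterlitzThouless

/-! ## §1 The lower envelope `dK⁻¹/dℓ ≥ A₁·y²` for the truncated flow -/

/-- The truncated recursion relations (`du/dℓ = A·y²`) satisfy the lower envelope
`dK⁻¹/dℓ ≥ A₁·y²` with `A₁ = A`. [cite: Nelson2002Defects, §2.2.3 eq. (2.61a)] -/
theorem IsFlowTrajectory.hasInvGrowth {A : ℝ} {u y : ℝ → ℝ} (h : IsFlowTrajectory A u y) :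
    ∀ ⦃l : ℝ⦄, 0 ≤ l → ∃ d : ℝ, HasDerivWithinAt u d (Ici 0) l ∧ A * y l ^ 2 ≤ d :=
  fun _ hl => ⟨_, h.hasDeriv_inv hl, le_rfl⟩

namespace IsPerturbedFlowTrajectory

variable {C : ℝ} {u y : ℝ → ℝ}

/-! ## §2 The window lemma: a backward Grönwall bound on `y⁻²` -/

/-- **Window lemma.** On a Kosterlitz-type trajectory the fugacity obeys `dy/dℓ ≤ 2y + C·y³`
(the linear rate `2 - π/u` is `< 2` and the remainder is `≤ C·y³`), i.e. `v = y⁻²` obeys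
`dv/dℓ ≥ -4v - 2C`, so `(y⁻² + C/2)·e^{4ℓ}` is non-decreasing: for `0 ≤ s ≤ t`,
`y(s)⁻² + C/2 ≤ (y(t)⁻² + C/2)·e^{4(t-s)}`. In words: if the fugacity is `≥ η` at a late scale `t`, it
was already bounded below, in terms of `η`, `C` and `t - s` only, on the whole window before `t` —
vortices cannot appear suddenly. [cite: Nelson2002Defects, §2.2.3 eq. (2.61b)] -/
theorem inv_sq_fug_le (h : IsPerturbedFlowTrajectory C u y) {s t : ℝ} (hs : 0 ≤ s) (hst : s ≤ t) :
    (y s ^ 2)⁻¹ + C / 2 ≤ ((y t ^ 2)⁻¹ + C / 2) * Real.exp (4 * (t - s)) := by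
  -- `H(r) = (y(r)⁻² + C/2)·e^{4r}` is non-decreasing on `[0, ∞)`
  set H : ℝ → ℝ := fun r => ((y r ^ 2)⁻¹ + C / 2) * Real.exp (4 * r) with hH
  have hHderiv : ∀ r, 0 ≤ r → ∃ d : ℝ, HasDerivWithinAt y d (Ici 0) r ∧
      |d - (2 - π / u r) * y r| ≤ C * y r ^ 3 ∧
      HasDerivWithinAt H (-(2 * y r * d) / (y r ^ 2) ^ 2 * Real.exp (4 * r) +
        ((y r ^ 2)⁻¹ + C / 2) * (Real.exp (4 * r) * 4)) (Ici 0) r := by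
    intro r hr
    obtain ⟨d, hd, hrem⟩ := h.hasDeriv_fug hr
    refine ⟨d, hd, hrem, ?_⟩
    have hyr : 0 < y r := h.fug_pos hr
    have hy2 : HasDerivWithinAt (fun x => y x ^ 2) (2 * y r * d) (Ici 0) r :=
      (hd.fun_pow 2).congr_deriv (by norm_num)
    have hinv : HasDerivWithinAt (fun x => (y x ^ 2)⁻¹) (-(2 * y r * d) / (y r ^ 2) ^ 2) (Ici 0) r :=
      hy2.inv (by positivity)
    have hadd : HasDerivWithinAt (fun x => (y x ^ 2)⁻¹ + C / 2) (-(2 * y r * d) / (y r ^ 2) ^ 2)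
        (Ici 0) r := hinv.add_const _
    have hexp : HasDerivWithinAt (fun x => Real.exp (4 * x)) (Real.exp (4 * r) * 4) (Ici 0) r := by
      have h1 : HasDerivWithinAt (fun x : ℝ => 4 * x) 4 (Ici 0) r := by
        simpa using ((hasDerivAt_id r).const_mul 4).hasDerivWithinAt
      exact h1.exp
    exact hadd.mul hexp
  have hHcont : ContinuousOn H (Ici 0) := by
    intro r hr
    obtain ⟨d, -, -, hHd⟩ := hHderiv r (mem_Ici.1 hr)
    exact hHd.continuousWithinAt
  have hHmono : MonotoneOn H (Ici 0) := by
    refine monotoneOn_of_deriv_nonneg (convex_Ici 0) hHcont ?_ ?_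
    · intro r hr
      rw [interior_Ici] at hr
      have hr0 : (0 : ℝ) < r := hr
      obtain ⟨d, -, -, hHd⟩ := hHderiv r hr0.le
      exact (hHd.hasDerivAt (Ici_mem_nhds hr0)).differentiableAt.differentiableWithinAt
    · intro r hr
      rw [interior_Ici] at hr
      have hr0 : (0 : ℝ) < r := hr
      obtain ⟨d, hd, hrem, hHd⟩ := hHderiv r hr0.le
      rw [(hHd.hasDerivAt (Ici_mem_nhds hr0)).deriv]
      have hyr : 0 < y r := h.fug_pos hr0.le
      have hur : 0 < u r := h.inv_pos_of_nonneg hr0.le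
      -- `d ≤ 2y + C y³`
      have hdle : d ≤ 2 * y r + C * y r ^ 3 := by
        have h1 : d ≤ (2 - π / u r) * y r + C * y r ^ 3 := by
          have := (abs_le.1 hrem).2
          linarith
        have h2 : (2 - π / u r) * y r ≤ 2 * y r := by
          have : 0 ≤ π / u r * y r := by positivity
          nlinarith
        linarith
      -- the derivative is `e^{4r} · 2y(2y + Cy³ - d)/y⁴ ≥ 0`
      have hkey : -(2 * y r * d) / (y r ^ 2) ^ 2 * Real.exp (4 * r) +
          ((y r ^ 2)⁻¹ + C / 2) * (Real.exp (4 * r) * 4) =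
          Real.exp (4 * r) * (2 * y r * (2 * y r + C * y r ^ 3 - d) / (y r ^ 2) ^ 2) := by
        field_simp
        ring
      rw [hkey]
      exact mul_nonneg (Real.exp_pos _).le
        (div_nonneg (mul_nonneg (by positivity) (by linarith)) (by positivity))
  have hmain : H s ≤ H t := hHmono (show s ∈ Ici 0 from hs) (show t ∈ Ici 0 from hs.trans hst) hst
  simp only [hH] at hmain
  -- divide by `e^{4s}`: `e^{4t} = e^{4(t-s)} · e^{4s}`
  have hexp_s : 0 < Real.exp (4 * s) := Real.exp_pos _
  have hsplit : Real.exp (4 * t) = Real.exp (4 * (t - s)) * Real.exp (4 * s) := by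
    rw [← Real.exp_add]
    ring_nf
  rw [hsplit, ← mul_assoc] at hmain
  exact le_of_mul_le_mul_right hmain hexp_s

/-! ## §3 `K⁻¹` converges or diverges; if it converges, the fugacity renormalises to zero -/

/-- **`K⁻¹(ℓ)` has a limit in `(0, ∞]`**: being non-decreasing, the running inverse stiffness either
converges to a finite `u_∞ ≥ K⁻¹(0)` or tends to `+∞`.
[cite: Nelson2002Defects, §2.2.3 eqs. (2.57), (2.61a), Fig. 2.6] -/
theorem exists_tendsto_or_tendsto_atTop (h : IsPerturbedFlowTrajectory C u y) :
    (∃ uinf : ℝ, u 0 ≤ uinf ∧ Tendsto u atTop (𝓝 uinf)) ∨ Tendsto u atTop atTop := by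
  set w : ℝ → ℝ := fun l => u (max l 0) with hw
  have hwmono : Monotone w := by
    intro a b hab
    exact h.monotoneOn_inv (show max a 0 ∈ Ici (0 : ℝ) from le_max_right a 0)
      (show max b 0 ∈ Ici (0 : ℝ) from le_max_right b 0) (max_le_max hab le_rfl)
  have hequ : w =ᶠ[atTop] u := by
    filter_upwards [eventually_ge_atTop (0 : ℝ)] with l hl
    simp only [hw, max_eq_left hl]
  by_cases hbdd : BddAbove (range w)
  · left
    refine ⟨⨆ l, w l, ?_, (tendsto_atTop_ciSup hwmono hbdd).congr' hequ⟩
    have := le_ciSup hbdd 0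
    simpa [hw] using this
  · right
    rw [not_bddAbove_iff] at hbdd
    have hw' : Tendsto w atTop atTop := hwmono.tendsto_atTop_atTop fun b => by
      obtain ⟨_, ⟨a, rfl⟩, hlt⟩ := hbdd b
      exact ⟨a, hlt.le⟩
    exact hw'.congr' hequ

/-- **If `K⁻¹(ℓ)` converges, the fugacity renormalises to zero** — given the lower envelope
`dK⁻¹/dℓ ≥ A₁·y²`, `A₁ > 0`. Otherwise `y(t) ≥ η` at arbitrarily late scales `t`; by the window lemma
`y² ≥ m(η, C) > 0` on `[t-1, t]`, so `K⁻¹(t) - K⁻¹(t-1) ≥ A₁·m` — impossible for a convergent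
(Cauchy) `K⁻¹`. So a trajectory whose inverse stiffness stays bounded IS a trajectory flowing into the
fixed line. [cite: Nelson2002Defects, §2.2.3 eqs. (2.61a,b), (2.70), Fig. 2.6] -/
theorem tendsto_fug_zero_of_tendsto_inv (h : IsPerturbedFlowTrajectory C u y) {A₁ : ℝ}
    (hA₁ : 0 < A₁)
    (hu : ∀ ⦃l : ℝ⦄, 0 ≤ l → ∃ d : ℝ, HasDerivWithinAt u d (Ici 0) l ∧ A₁ * y l ^ 2 ≤ d)
    {uinf : ℝ} (hulim : Tendsto u atTop (𝓝 uinf)) : Tendsto y atTop (𝓝 0) := by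
  have hC : 0 ≤ C := h.coeff_nonneg
  rw [tendsto_order]
  refine ⟨fun a ha => ?_, fun η hη => ?_⟩
  · filter_upwards [eventually_ge_atTop (0 : ℝ)] with l hl using ha.trans (h.fug_pos hl)
  · -- the window bound: `y(t) ≥ η` forces `y(s)² ≥ m` for `s ∈ [t-1, t]`
    set m : ℝ := (((η ^ 2)⁻¹ + C / 2) * Real.exp 4)⁻¹ with hm
    have hm_pos : 0 < m := by positivity
    have hε : 0 < A₁ * m / 4 := by positivity
    obtain ⟨L, hL⟩ := Metric.tendsto_atTop.1 hulim (A₁ * m / 4) hε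
    refine eventually_atTop.2 ⟨max L 0 + 1, fun t ht => ?_⟩
    by_contra hge
    push Not at hge
    have hL0 : 0 ≤ max L 0 := le_max_right L 0
    have ht1 : 0 ≤ t - 1 := by linarith
    have hwin : ∀ s, t - 1 ≤ s → s ≤ t → m ≤ y s ^ 2 := by
      intro s hs1 hs2
      have hs0 : 0 ≤ s := ht1.trans hs1
      have hW := h.inv_sq_fug_le hs0 hs2
      have hys : 0 < y s := h.fug_pos hs0
      have hyt : 0 < y t := h.fug_pos (hs0.trans hs2)
      have h1 : (y t ^ 2)⁻¹ ≤ (η ^ 2)⁻¹ := by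
        refine inv_anti₀ (by positivity) ?_
        nlinarith
      have h2 : Real.exp (4 * (t - s)) ≤ Real.exp 4 := Real.exp_le_exp.2 (by linarith)
      have h3 : ((y t ^ 2)⁻¹ + C / 2) * Real.exp (4 * (t - s)) ≤ ((η ^ 2)⁻¹ + C / 2) * Real.exp 4 :=
        mul_le_mul (by linarith) h2 (Real.exp_pos _).le (by positivity)
      have h4 : (y s ^ 2)⁻¹ ≤ ((η ^ 2)⁻¹ + C / 2) * Real.exp 4 := by linarith
      have h5 : (((η ^ 2)⁻¹ + C / 2) * Real.exp 4)⁻¹ ≤ ((y s ^ 2)⁻¹)⁻¹ := inv_anti₀ (by positivity) h4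
      rw [inv_inv] at h5
      simpa [hm] using h5
    -- over the unit window `K⁻¹` gains at least `A₁ m`
    have hmvt : A₁ * m * (t - (t - 1)) ≤ u t - u (t - 1) := by
      refine (convex_Icc (t - 1) t).mul_sub_le_image_sub_of_le_deriv ?_ ?_ ?_ (t - 1)
        ⟨le_rfl, by linarith⟩ t ⟨by linarith, le_rfl⟩ (by linarith)
      · intro s hs
        obtain ⟨d, hd, -⟩ := hu (ht1.trans hs.1)
        exact hd.continuousWithinAt.mono fun x hx => ht1.trans hx.1
      · intro s hs
        rw [interior_Icc] at hs
        have hs0 : 0 < s := ht1.trans_lt hs.1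
        obtain ⟨d, hd, -⟩ := hu hs0.le
        exact (hd.hasDerivAt (Ici_mem_nhds hs0)).differentiableAt.differentiableWithinAt
      · intro s hs
        rw [interior_Icc] at hs
        have hs0 : 0 < s := ht1.trans_lt hs.1
        obtain ⟨d, hd, hdge⟩ := hu hs0.le
        rw [(hd.hasDerivAt (Ici_mem_nhds hs0)).deriv]
        have := hwin s hs.1.le hs.2.le
        nlinarith
    have hgain : A₁ * m ≤ u t - u (t - 1) := by
      have : A₁ * m * (t - (t - 1)) = A₁ * m := by ring
      rw [this] at hmvt
      exact hmvt
    -- but `K⁻¹` is Cauchy: both `u t` and `u (t-1)` are within `A₁ m / 4` of the limit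
    have d1 := hL t (by linarith [le_max_left L 0])
    have d2 := hL (t - 1) (by linarith [le_max_left L 0])
    rw [Real.dist_eq] at d1 d2
    have e1 := (abs_lt.1 d1).2
    have e2 := (abs_lt.1 d2).1
    have : A₁ * m ≤ A₁ * m / 2 := by linarith
    linarith

/-- **The dichotomy.** On every Kosterlitz-type trajectory with `dK⁻¹/dℓ ≥ A₁·y²` (`A₁ > 0`):
EITHER the fugacity renormalises to zero (`y(ℓ) → 0`: the trajectory flows into the fixed line,
the ordered phase) OR the inverse stiffness diverges (`K⁻¹(ℓ) → ∞`: the stiffness renormalises to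
zero, the disordered phase). The two flows of Nelson 2002, Fig. 2.6 exhaust the possibilities for
the un-truncated equations as well. [cite: Nelson2002Defects, §2.2.3 eqs. (2.61a,b), Fig. 2.6] -/
theorem tendsto_fug_zero_or_tendsto_atTop (h : IsPerturbedFlowTrajectory C u y) {A₁ : ℝ}
    (hA₁ : 0 < A₁)
    (hu : ∀ ⦃l : ℝ⦄, 0 ≤ l → ∃ d : ℝ, HasDerivWithinAt u d (Ici 0) l ∧ A₁ * y l ^ 2 ≤ d) :
    Tendsto y atTop (𝓝 0) ∨ Tendsto u atTop atTop := by
  rcases h.exists_tendsto_or_tendsto_atTop with ⟨uinf, -, hulim⟩ | htop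
  · exact Or.inl (h.tendsto_fug_zero_of_tendsto_inv hA₁ hu hulim)
  · exact Or.inr htop

/-- The two alternatives exclude each other: if `K⁻¹ → ∞` then the trajectory passes `K⁻¹ = π/2`
and the fugacity does not renormalise to zero (`not_tendsto_fug_zero_of_lt_inv`).
[cite: Nelson2002Defects, §2.2.3 eq. (2.61b), Fig. 2.6] -/
theorem not_tendsto_fug_zero_of_tendsto_atTop (h : IsPerturbedFlowTrajectory C u y)
    (htop : Tendsto u atTop atTop) : ¬ Tendsto y atTop (𝓝 0) := by
  obtain ⟨L, hL⟩ := eventually_atTop.1 (htop.eventually_gt_atTop (π / 2))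
  exact h.not_tendsto_fug_zero_of_lt_inv (le_max_right L 0) (hL (max L 0) (le_max_left L 0))

/-! ## §4 Quantisation of the renormalised stiffness: `K_R ∈ {0} ∪ [2/π, K(0)]` -/

/-- **The renormalised stiffness exists and is `0` or at least `2/π`.** On every Kosterlitz-type
trajectory with `dK⁻¹/dℓ ≥ A₁·y²` (`A₁ > 0`) the running stiffness `K(ℓ) = (K⁻¹(ℓ))⁻¹` converges
to some `K_R`, and either `K_R = 0` (disordered) or `2/π ≤ K_R ≤ K(0)` with `y → 0` (ordered):
no renormalised stiffness strictly between `0` and `2/π` occurs — the content of the universal line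
of Nelson 2002, Fig. 2.8, below which no curve terminates.
[cite: Nelson2002Defects, §2.2.3 eqs. (2.70)–(2.72), Figs. 2.6, 2.8] -/
theorem exists_tendsto_stiffness_dichotomy (h : IsPerturbedFlowTrajectory C u y) {A₁ : ℝ}
    (hA₁ : 0 < A₁)
    (hu : ∀ ⦃l : ℝ⦄, 0 ≤ l → ∃ d : ℝ, HasDerivWithinAt u d (Ici 0) l ∧ A₁ * y l ^ 2 ≤ d) :
    ∃ KR : ℝ, Tendsto (fun l => (u l)⁻¹) atTop (𝓝 KR) ∧
      (KR = 0 ∨ (2 / π ≤ KR ∧ KR ≤ (u 0)⁻¹ ∧ Tendsto y atTop (𝓝 0))) := by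
  rcases h.tendsto_fug_zero_or_tendsto_atTop hA₁ hu with hy | htop
  · obtain ⟨KR, h1, h2, h3⟩ := h.exists_tendsto_stiffness_of_tendsto_fug_zero hy
    exact ⟨KR, h3, Or.inr ⟨h1, h2, hy⟩⟩
  · exact ⟨0, tendsto_inv_atTop_zero.comp htop, Or.inl rfl⟩

/-- **A positive renormalised stiffness is at least `2/π`** (and then the trajectory flows into the
fixed line): if `K(ℓ) → K` with `K > 0` on a Kosterlitz-type trajectory with `dK⁻¹/dℓ ≥ A₁·y²`, then
`2/π ≤ K` and `y(ℓ) → 0`. [cite: Nelson2002Defects, §2.2.3 eqs. (2.70)–(2.72), Fig. 2.8] -/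
theorem two_div_pi_le_of_tendsto_stiffness_pos (h : IsPerturbedFlowTrajectory C u y) {A₁ : ℝ}
    (hA₁ : 0 < A₁)
    (hu : ∀ ⦃l : ℝ⦄, 0 ≤ l → ∃ d : ℝ, HasDerivWithinAt u d (Ici 0) l ∧ A₁ * y l ^ 2 ≤ d)
    {K : ℝ} (hK : 0 < K) (hlim : Tendsto (fun l => (u l)⁻¹) atTop (𝓝 K)) :
    2 / π ≤ K ∧ Tendsto y atTop (𝓝 0) := by
  obtain ⟨KR, hKR, hcases⟩ := h.exists_tendsto_stiffness_dichotomy hA₁ hu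
  have heq : K = KR := tendsto_nhds_unique hlim hKR
  rcases hcases with h0 | ⟨h1, -, hy⟩
  · exfalso
    rw [h0] at heq
    linarith
  · rw [heq]
    exact ⟨h1, hy⟩

end IsPerturbedFlowTrajectory

/-! ## §5 Bridges: `StableBelow` from the identification alone -/

/-- **`StableBelow` from the identification and positivity of the stiffness.** Let `ρ` be a
stiffness profile, positive on `(0, T_c)`, and suppose that at every `0 < T < T_c` the reduced
stiffness `ρ(T)/T` IS the limit `lim_ℓ K_T(ℓ)` of some Kosterlitz-type trajectory with a lower
envelope `dK⁻¹/dℓ ≥ A₁·y²`, `A₁ > 0` (remainder constants and `A₁` may depend on `T`). Then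
`(2/π)·T ≤ ρ(T)` on `(0, T_c)`: `KosterlitzThouless.StableBelow ρ T_c`. Nothing is assumed about
which side of the separatrix the bare couplings lie on — positivity of the measured stiffness
decides it. [cite: Nelson2002Defects, §2.2.3 eqs. (2.70)–(2.72)] -/
theorem stableBelow_of_pos_of_robustFlowLimit {ρ : ℝ → ℝ} {Tc : ℝ}
    (hpos : ∀ ⦃T : ℝ⦄, 0 < T → T < Tc → 0 < ρ T)
    (hflow : ∀ ⦃T : ℝ⦄, 0 < T → T < Tc → ∃ (A₁ C : ℝ) (u y : ℝ → ℝ), 0 < A₁ ∧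
      IsPerturbedFlowTrajectory C u y ∧
      (∀ ⦃l : ℝ⦄, 0 ≤ l → ∃ d : ℝ, HasDerivWithinAt u d (Ici 0) l ∧ A₁ * y l ^ 2 ≤ d) ∧
      Tendsto (fun l => (u l)⁻¹) atTop (𝓝 (ρ T / T))) :
    StableBelow ρ Tc := by
  intro T hT hTTc
  obtain ⟨A₁, C, u, y, hA₁, htraj, hu, hlim⟩ := hflow hT hTTc
  have hq : 0 < ρ T / T := div_pos (hpos hT hTTc) hT
  have h1 := (htraj.two_div_pi_le_of_tendsto_stiffness_pos hA₁ hu hq hlim).1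
  rwa [le_div_iff₀ hT] at h1

/-- **`StableBelow` from the identification alone, `T_c` being READ OFF the stiffness curve.** If
`T_c` is the stiffness transition of `ρ` in the sense of `KosterlitzThouless.IsTransitionAt`
(`ρ > 0` on `(0, T_c)`, `ρ = 0` above) and at every `0 < T < T_c` the reduced stiffness `ρ(T)/T` is
the limit stiffness of a Kosterlitz-type trajectory with a lower envelope, then
`KosterlitzThouless.StableBelow ρ T_c` — the hypothesis of the bound of record
`le_pi_div_two_mul_of_stableBelow`. [cite: Nelson2002Defects, §2.2.3 eq. (2.70); §6.2 Fig. 6.2] -/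
theorem stableBelow_of_isTransitionAt_of_robustFlowLimit {ρ : ℝ → ℝ} {Tc : ℝ}
    (hTr : IsTransitionAt ρ Tc)
    (hflow : ∀ ⦃T : ℝ⦄, 0 < T → T < Tc → ∃ (A₁ C : ℝ) (u y : ℝ → ℝ), 0 < A₁ ∧
      IsPerturbedFlowTrajectory C u y ∧
      (∀ ⦃l : ℝ⦄, 0 ≤ l → ∃ d : ℝ, HasDerivWithinAt u d (Ici 0) l ∧ A₁ * y l ^ 2 ≤ d) ∧
      Tendsto (fun l => (u l)⁻¹) atTop (𝓝 (ρ T / T))) :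
    StableBelow ρ Tc :=
  stableBelow_of_pos_of_robustFlowLimit hTr.1 hflow

/-- **The bound of record from the identification alone**: under the hypotheses of
`stableBelow_of_isTransitionAt_of_robustFlowLimit`, `T_c > 0` and any ceiling `ρ(T) ≤ ρ̄` on
`(0, T_c)` give `T_c ≤ (π/2)·ρ̄`. [cite: Nelson2002Defects, §2.2.3 eqs. (2.70)–(2.72)] -/
theorem le_pi_div_two_mul_of_isTransitionAt_of_robustFlowLimit {ρ : ℝ → ℝ} {Tc ρbar : ℝ}
    (hTc : 0 < Tc) (hTr : IsTransitionAt ρ Tc)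
    (hflow : ∀ ⦃T : ℝ⦄, 0 < T → T < Tc → ∃ (A₁ C : ℝ) (u y : ℝ → ℝ), 0 < A₁ ∧
      IsPerturbedFlowTrajectory C u y ∧
      (∀ ⦃l : ℝ⦄, 0 ≤ l → ∃ d : ℝ, HasDerivWithinAt u d (Ici 0) l ∧ A₁ * y l ^ 2 ≤ d) ∧
      Tendsto (fun l => (u l)⁻¹) atTop (𝓝 (ρ T / T)))
    (hceil : ∀ ⦃T : ℝ⦄, 0 < T → T < Tc → ρ T ≤ ρbar) : Tc ≤ π / 2 * ρbar :=
  le_pi_div_two_mul_of_stableBelow (stableBelow_of_isTransitionAt_of_robustFlowLimit hTr hflow)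
    hTc hceil

end KosterlitzThouless

end Literature.MathematicalPhysics.StatisticalMechanics
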